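import Mathlib
import Literature.Dynamics.Hamiltonian.KaloshinZhang2020.TheoremShapes
import Literature.Dynamics.Hamiltonian.KaloshinZhang2020.GenericityClasses

/-!
# Kaloshin–Zhang 2020 vs Cheng–Xue (v5 / Sci. China Math. 2023): the KZ genericity class does NOT imply the
OPEN-DENSE-directions class, at the level of the typed classes (kernel-checked counterexample)

CITATION HEADER (lean-in-tree rule 2026-08-18). Sources: V. Kaloshin, K. Zhang, *Arnold diffusion for smooth
systems of two and a half degrees of freedom*, Annals of Mathematics Studies 208 (Princeton UP, 2020), Theorem 1.2
(§1.1 — scan chunk p0008 of the held unpaginated copy; printed page not held, §1.1 = printed pp. 3–7 by the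
book's table of contents) = bib key `KaloshinZhang2020` (class `KZCuspGeneric`, `TheoremShapes.lean`); C.-Q. Cheng, J. Xue, *Arnold
diffusion in nearly integrable Hamiltonian systems of arbitrary degrees of freedom*, arXiv:1503.04153v5
`n-diffusion05082019.tex` l.208 (text sent to print = Sci. China Math. 66 (2023)) = bib key `ChengXue2023`
(class `CXCuspOpenDense`: "Let ℜ_a be a set open-dense in 𝔖_a, each P ∈ ℜ_a is associated with a set R_P residual
in the interval [0,a_P] with a_P ≤ a"; the 2015 wording "residual in 𝔖_a" is `CXCuspResidual`). Written by the
pub-arnold near-miss cell (LEMMAS §3 node G8′, DIVERGENCE D30, GAPS 2026-08-18T18:45Z item 4(a)).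

WHAT IS PROVED. Over ANY finite-dimensional real normed space `Pert` of dimension ≥ 2 there are a direction set
`𝒰` (the whole unit sphere) and a property `Good` such that `KZCuspGeneric 𝒰 Good` holds (hence, by the accepted
theorem `KZCuspGeneric.cxCuspResidual`, `CXCuspResidual a Good` holds for every `a > 0`) while `CXCuspOpenDense a Good`
FAILS for every `a`. Consequently the implication "KZ-class ⇒ CX-class" proved in `GenericityClasses.lean` is a
statement about the 2015 (residual-directions) class ONLY; for the class printed in 2023 the two genericity
notions differ by a SECOND input (openness of the set of good directions), independent of the regularity
hypothesis (l) on `P ↦ a_P` that governs the converse direction (`CuspDensity.lean`).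

THE EXAMPLE. Fix a dense sequence of unit directions `d₀, d₁, …` (the sphere of a finite-dimensional space is
separable). Declare `P` BAD iff `P = t • dₙ` for some `n` and some amplitude `0 ≤ t ≤ 1/(n+1)`, GOOD otherwise.
The good set is open away from `0` (near a point of norm `λ` only finitely many bad segments have length `≥ λ/2`,
and those are compact) and dense (the bad set lies in a countable union of lines, each a closed proper subspace,
hence meagre — Baire), so `Good` holds on an open dense subset of the KZ cusp `{0 < ‖P‖ < 1}`. But an OPEN dense
set of directions must contain some `dₙ`, over which every residual (hence dense) amplitude set `R ⊆ [0, a_P]`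
contains a `t < 1/(n+1)` with `t • dₙ` bad.

Same abstract mechanism as `CuspSlicesCounterexample.lean` (directions `ℝ`, heights `1`), now in the vocabulary of
the typed classes `KZCuspGeneric` / `CXCuspOpenDense` on a genuine normed space. Label: KERNEL-PROVED, point-set
topology, [folklore]; adjudicates nothing about the dynamics (it says what the abstract slice / Kuratowski–Ulam
argument can and cannot deliver, not whether the dynamical sets of arXiv:1503.04153v5 happen to be open).
-/

open Set Filter Topology Metric
open scoped Pointwise

namespace Literature.Dynamics.Hamiltonian.KaloshinZhang2020

variable {Pert : Type} [NormedAddCommGroup Pert] [NormedSpace ℝ Pert]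

/-- The closed segment `{t • d : 0 ≤ t ≤ c}` of amplitudes `≤ c` over the direction `d`. [folklore] -/
def badSeg (d : Pert) (c : ℝ) : Set Pert := (fun t : ℝ => t • d) '' Icc 0 c

/-- The bad set of the example: over the `n`-th direction, all amplitudes `≤ 1/(n+1)`. [folklore] -/
def badSet (d : ℕ → Pert) : Set Pert := ⋃ n : ℕ, badSeg (d n) (1 / ((n : ℝ) + 1))

/-- The good property of the example: not on any bad segment. [folklore] -/
def GoodEx (d : ℕ → Pert) (P : Pert) : Prop := P ∉ badSet d

/-- A bad segment is compact, hence closed. [folklore] -/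
theorem isClosed_badSeg (d : Pert) (c : ℝ) : IsClosed (badSeg d c) :=
  (isCompact_Icc.image (continuous_id.smul continuous_const)).isClosed

/-- Points of a bad segment over a unit direction have norm `≤ c`. [folklore] -/
theorem norm_le_of_mem_badSeg {d : Pert} (hd : ‖d‖ = 1) {c : ℝ} {P : Pert} (hP : P ∈ badSeg d c) :
    ‖P‖ ≤ c := by
  obtain ⟨t, ⟨ht0, htc⟩, rfl⟩ := hP
  rw [norm_smul, Real.norm_eq_abs, hd, mul_one, abs_of_nonneg ht0]
  exact htc

/-- A bad segment lies on the line spanned by its direction. [folklore] -/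
theorem badSeg_subset_span (d : Pert) (c : ℝ) : badSeg d c ⊆ (Submodule.span ℝ {d} : Set Pert) := by
  rintro _ ⟨t, -, rfl⟩
  exact Submodule.smul_mem _ _ (Submodule.mem_span_singleton_self d)

/-- The KZ cusp over the whole sphere with constant height `1` is the punctured open unit ball. [folklore] -/
theorem cusp_unitSphere_one :
    cusp (unitSphere Pert) (fun _ => (1 : ℝ)) = {P : Pert | 0 < ‖P‖ ∧ ‖P‖ < 1} := by
  ext P
  constructor
  · rintro ⟨H₁, hH₁, ε, hε0, hε1, rfl⟩
    have h1 : ‖H₁‖ = 1 := by simpa [unitSphere] using hH₁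
    simp only [mem_setOf_eq, norm_smul, Real.norm_eq_abs, h1, mul_one, abs_of_pos hε0]
    exact ⟨hε0, hε1⟩
  · rintro ⟨h0, h1⟩
    refine ⟨‖P‖⁻¹ • P, ?_, ‖P‖, h0, h1, ?_⟩
    · simp only [unitSphere, mem_sphere_zero_iff_norm, norm_smul, norm_inv, norm_norm]
      exact inv_mul_cancel₀ h0.ne'
    · rw [smul_smul, mul_inv_cancel₀ h0.ne', one_smul]

/-- The punctured open unit ball is open. [folklore] -/
theorem isOpen_cusp_unitSphere_one : IsOpen (cusp (unitSphere Pert) (fun _ => (1 : ℝ))) := by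
  rw [cusp_unitSphere_one]
  exact isOpen_Ioo.preimage continuous_norm

/-- Away from `0` the good set is open: only finitely many bad segments reach norm `≥ λ/2`, and they are closed. [folklore] -/
theorem isOpen_goodEx_pos (d : ℕ → Pert) (hd : ∀ n, ‖d n‖ = 1) :
    IsOpen {P : Pert | 0 < ‖P‖ ∧ GoodEx d P} := by
  rw [isOpen_iff_forall_mem_open]
  rintro P ⟨hP0, hPg⟩
  obtain ⟨N, hN⟩ := exists_nat_one_div_lt (half_pos hP0)
  set F : Set Pert := ⋃ n ∈ Finset.range N, badSeg (d n) (1 / ((n : ℝ) + 1)) with hF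
  have hFc : IsClosed F := isClosed_biUnion_finset fun n _ => isClosed_badSeg _ _
  have hPF : P ∉ F := by
    intro hPF
    apply hPg
    obtain ⟨n, -, hn⟩ := mem_iUnion₂.mp hPF
    exact mem_iUnion.mpr ⟨n, hn⟩
  refine ⟨ball P (‖P‖ / 2) ∩ Fᶜ, ?_, isOpen_ball.inter hFc.isOpen_compl, mem_ball_self (half_pos hP0), hPF⟩
  rintro Q ⟨hQb, hQF⟩
  have hQn : ‖P‖ / 2 < ‖Q‖ := by
    have h1 : dist Q P < ‖P‖ / 2 := hQb
    have h2 : ‖P‖ - ‖Q‖ ≤ ‖P - Q‖ := norm_sub_norm_le P Q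
    rw [dist_eq_norm, ← norm_neg, neg_sub] at h1
    linarith
  refine ⟨by linarith [norm_nonneg Q], ?_⟩
  intro hQbad
  obtain ⟨n, hn⟩ := mem_iUnion.mp hQbad
  by_cases hnN : n < N
  · exact hQF (mem_iUnion₂.mpr ⟨n, Finset.mem_range.mpr hnN, hn⟩)
  · have hnN' : N ≤ n := not_lt.mp hnN
    have h1 : ‖Q‖ ≤ 1 / ((n : ℝ) + 1) := norm_le_of_mem_badSeg (hd n) hn
    have h2 : 1 / ((n : ℝ) + 1) ≤ 1 / ((N : ℝ) + 1) := by
      gcongr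
    linarith

/-- The bad set is meagre when every direction spans a proper subspace (true in dimension `≥ 2`): it lies in a
countable union of closed lines with empty interior. Hence the good set is dense (Baire). [folklore] -/
theorem dense_goodEx [CompleteSpace Pert] (d : ℕ → Pert)
    (hprop : ∀ n, Submodule.span ℝ {d n} ≠ ⊤) : Dense {P : Pert | GoodEx d P} := by
  have hmeagre : IsMeagre (⋃ n : ℕ, (Submodule.span ℝ {d n} : Set Pert)) := by
    refine isMeagre_iUnion fun n => ?_
    refine IsNowhereDense.isMeagre ?_
    have hcl : IsClosed (Submodule.span ℝ {d n} : Set Pert) := Submodule.closed_of_finiteDimensional _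
    rw [hcl.isNowhereDense_iff]
    by_contra hne
    rw [← Ne, ← nonempty_iff_ne_empty] at hne
    exact hprop n (Submodule.eq_top_of_nonempty_interior' _ hne)
  have hdense : Dense (⋃ n : ℕ, (Submodule.span ℝ {d n} : Set Pert))ᶜ := dense_of_mem_residual hmeagre
  refine hdense.mono ?_
  intro P hP hPbad
  apply hP
  obtain ⟨n, hn⟩ := mem_iUnion.mp hPbad
  exact mem_iUnion.mpr ⟨n, badSeg_subset_span _ _ hn⟩

/-- **The example is KZ-cusp-generic**: `𝒰` = the whole sphere, `ε₀ ≡ 1`, `𝒲 = cusp ∩ Good` open dense in the cusp. [folklore] -/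
theorem kzCuspGeneric_goodEx [CompleteSpace Pert] (d : ℕ → Pert) (hd : ∀ n, ‖d n‖ = 1)
    (hprop : ∀ n, Submodule.span ℝ {d n} ≠ ⊤) : KZCuspGeneric (unitSphere Pert) (GoodEx d) := by
  refine ⟨⟨subset_rfl, ?_, ?_⟩, fun _ => (1 : ℝ), lowerSemicontinuous_const, fun _ => zero_le_one,
    fun _ _ => zero_lt_one, cusp (unitSphere Pert) (fun _ => (1 : ℝ)) ∩ {P | GoodEx d P},
    ⟨inter_subset_left, ?_, ?_⟩, fun P hP => hP.2⟩
  · simp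
  · simp
  · -- relatively open: on the cusp, `𝒲` coincides with the open set `{0 < ‖P‖ ∧ Good P}`
    have h1 : (Subtype.val ⁻¹' (cusp (unitSphere Pert) (fun _ => (1 : ℝ)) ∩ {P | GoodEx d P}) :
        Set (cusp (unitSphere Pert) (fun _ => (1 : ℝ)))) =
        Subtype.val ⁻¹' {P : Pert | 0 < ‖P‖ ∧ GoodEx d P} := by
      ext ⟨P, hP⟩
      have hP' : 0 < ‖P‖ ∧ ‖P‖ < 1 := by
        have := hP
        rwa [cusp_unitSphere_one] at this
      simp only [mem_preimage, mem_inter_iff, mem_setOf_eq]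
      exact ⟨fun h => ⟨hP'.1, h.2⟩, fun h => ⟨hP, h.2⟩⟩
    rw [h1]
    exact (isOpen_goodEx_pos d hd).preimage continuous_subtype_val
  · rw [Subtype.dense_iff, Subtype.image_preimage_coe]
    have h1 := (dense_goodEx d hprop).open_subset_closure_inter isOpen_cusp_unitSphere_one
    exact h1.trans (closure_mono fun P hP => ⟨hP.1, hP⟩)

/-- **The example is NOT cusp-generic in the v5 / 2023 sense** (open-dense set of directions), for any `a`: an open
dense `ℜ` contains some `dₙ`, and a residual (hence dense) amplitude set in `[0, a_P]` contains a `t < 1/(n+1)`. [folklore] -/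
theorem not_cxCuspOpenDense_goodEx (d : ℕ → unitSphere Pert) (hd : DenseRange d) (a : ℝ) :
    ¬ CXCuspOpenDense a (GoodEx fun n => (d n : Pert)) := by
  rintro ⟨ℜ, hopen, hdense, h⟩
  haveI : Nonempty (unitSphere Pert) := ⟨d 0⟩
  obtain ⟨n, hn⟩ := hd.exists_mem_open hopen hdense.nonempty
  obtain ⟨aP, haP, -, R, hRsub, hRres, hgood⟩ := h (d n) hn
  set c : ℝ := min aP (1 / ((n : ℝ) + 1)) with hc
  have hc0 : 0 < c := lt_min haP (by positivity)
  have hRd : Dense (Subtype.val ⁻¹' R : Set (Icc (0 : ℝ) aP)) := dense_of_mem_residual hRres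
  have hVopen : IsOpen {x : Icc (0 : ℝ) aP | (x : ℝ) < c} := isOpen_Iio.preimage continuous_subtype_val
  have hVne : ({x : Icc (0 : ℝ) aP | (x : ℝ) < c} : Set (Icc (0 : ℝ) aP)).Nonempty :=
    ⟨⟨0, le_rfl, haP.le⟩, hc0⟩
  obtain ⟨⟨t, ht0, ht1⟩, htR, htc⟩ := hRd.exists_mem_open hVopen hVne
  have htc' : t < c := htc
  apply hgood t htR
  refine mem_iUnion.mpr ⟨n, t, ⟨ht0, ?_⟩, rfl⟩
  exact le_of_lt (lt_of_lt_of_le htc' (min_le_right _ _))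

/-- **KZ-class ⇏ CX-v5-class at the level of the typed classes.** In every finite-dimensional real normed space of
dimension `≥ 2` there are `𝒰`, `Good` with `KZCuspGeneric 𝒰 Good` (so `CXCuspResidual a Good` for all `a > 0` by
`KZCuspGeneric.cxCuspResidual`) and `¬ CXCuspOpenDense a Good` for every `a`. [folklore] -/
theorem exists_kzCuspGeneric_not_cxCuspOpenDense [FiniteDimensional ℝ Pert]
    (h2 : 2 ≤ Module.finrank ℝ Pert) :
    ∃ (𝒰 : Set Pert) (Good : Pert → Prop), KZCuspGeneric 𝒰 Good ∧
      (∀ a : ℝ, 0 < a → CXCuspResidual a Good) ∧ ∀ a : ℝ, ¬ CXCuspOpenDense a Good := by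
  -- a unit vector exists
  have hnt : ∃ v : Pert, v ≠ 0 := (Module.finrank_pos_iff_exists_ne_zero (R := ℝ) (M := Pert)).mp (by omega)
  obtain ⟨v, hv⟩ := hnt
  haveI : Nonempty (unitSphere Pert) := ⟨⟨‖v‖⁻¹ • v, by
    simp only [unitSphere, mem_sphere_zero_iff_norm, norm_smul, norm_inv, norm_norm]
    exact inv_mul_cancel₀ (norm_ne_zero_iff.mpr hv)⟩⟩
  obtain ⟨d, hd⟩ := TopologicalSpace.exists_dense_seq (unitSphere Pert)
  have hdn : ∀ n, ‖(d n : Pert)‖ = 1 := fun n => mem_sphere_zero_iff_norm.mp (d n).2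
  have hprop : ∀ n, Submodule.span ℝ {(d n : Pert)} ≠ ⊤ := by
    intro n htop
    have h1 : Module.finrank ℝ (Submodule.span ℝ {(d n : Pert)}) = 1 :=
      finrank_span_singleton (by rw [← norm_ne_zero_iff, hdn n]; exact one_ne_zero)
    rw [htop, finrank_top] at h1
    omega
  refine ⟨unitSphere Pert, GoodEx fun n => (d n : Pert), kzCuspGeneric_goodEx _ hdn hprop, ?_, ?_⟩
  · exact fun a ha => (kzCuspGeneric_goodEx _ hdn hprop).cxCuspResidual ha
  · exact not_cxCuspOpenDense_goodEx d hd

/-- The concrete instance `Pert = ℝ²`. [folklore] -/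
theorem exists_kzCuspGeneric_not_cxCuspOpenDense_R2 :
    ∃ (𝒰 : Set (EuclideanSpace ℝ (Fin 2))) (Good : EuclideanSpace ℝ (Fin 2) → Prop),
      KZCuspGeneric 𝒰 Good ∧ (∀ a : ℝ, 0 < a → CXCuspResidual a Good) ∧ ∀ a : ℝ, ¬ CXCuspOpenDense a Good :=
  exists_kzCuspGeneric_not_cxCuspOpenDense (by simp)

end Literature.Dynamics.Hamiltonian.KaloshinZhang2020
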